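import Mathlib.MeasureTheory.Function.LpSeminorm.CompareExp
import Mathlib.MeasureTheory.Function.LpSeminorm.TriangleInequality
import Mathlib.MeasureTheory.Function.LpSeminorm.SMul
import Literature.Analysis.FunctionSpaces.TorusMollifiedFieldFourierBounds
import Literature.Analysis.FunctionSpaces.TorusSpaceTimeKernel
import Literature.Analysis.FunctionSpaces.TorusSpaceTimeFields
import HarnessLib

/-!
# An `L³((0,T) × T^d)` Cauchy criterion for jointly smooth fields: Besov bound in space,
# convergence of the Fourier modes in time

Analysis/FunctionSpaces support file (theorem-only). The space-direction half of the
Aubin–Lions–Simon compactness argument for smooth solutions of evolution equations on the flat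
torus, carried out on the Fourier side (Simon 1987, §8; De Rosa–Isett 2024, §6.1;
Robinson–Rodrigo–Sadowski 2016, Thm. 4.4, Step 3): a sequence of jointly smooth fields
`w_n : (0,T) × T^d → ℝ^d` with

* a uniform bound `∫₀ᵀ ‖w_n(t)‖³_{B^θ_{3,∞}} dt ≤ B` (`θ > 0`; `eBesovSupNorm`, `BesovDifference`), and
* Fourier modes that are Cauchy in `L³(0,T)`, one frequency at a time:
  `∫₀ᵀ ‖ŵ_n(t,k) - ŵ_m(t,k)‖³ dt → 0` as `n, m → ∞`, for every `k ∈ ℤ^d`,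

is a Cauchy sequence in `L³((0,T) × T^d)`
(`Torus.exists_forall_lintegral_sub_pow_three_le_of_modes`). Proof: split
`w_n - w_m = (w_n - ρ_ε ⋆ w_n) - (w_m - ρ_ε ⋆ w_m) + ρ_ε ⋆ (w_n - w_m)` with the standard mollifier
`ρ_ε = Torus.kernel ε`; the first two terms are `≤ ε^θ B^{1/3}` in `L³_{t,x}` by the Besov
mollification error (`Torus.eLpNorm_kernel_convolution_sub_self_le_eBesovSupSeminorm`, CET (6)),
and the mollified difference is bounded pointwise by finitely many Fourier modes of the difference
plus `‖w_n(t) - w_m(t)‖_{L¹}` times the Fourier tail `∑_{|k|>K} |ρ̂_ε(k)|` of the mollifier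
(`Torus.norm_kernel_convolution_apply_le`), which is small for `K` large
(`Torus.tendsto_tsum_compl_norm_mFourierCoeff_kernel`).

## Mathlib search

Mathlib (this pin): `eLpNorm_add_le`, `eLpNorm_sum_le`, `eLpNorm_le_eLpNorm_of_exponent_le`,
`lintegral_prod`, `ENNReal.rpow_inv_natCast_pow` (the cube-root identities are kept local: the
tree's `FluidPDE.rpow_third_pow_three` is not importable into `FunctionSpaces` by layering); no Aubin–Lions–Simon compactness theorem and no
Besov classes (tree: `BesovDifference`, `TorusMollifiedFieldFourierBounds`, `TorusSpaceTimeKernel`).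

## References

* J. Simon, *Compact sets in the space `L^p(0,T;B)`*, Ann. Mat. Pura Appl. (4) 146 (1987),
  65–96, §8. [Simon1986]
* L. De Rosa, P. Isett, Arch. Ration. Mech. Anal. 248 (2024), Paper No. 11, §6.1. [DeRosaIsett2024]
* J. C. Robinson, J. L. Rodrigo, W. Sadowski, *The Three-Dimensional Navier–Stokes Equations*
  (CUP 2016), Thm. 4.4, Step 3. [RobinsonRodrigoSadowski2016]
* P. Constantin, W. E, E. S. Titi, Comm. Math. Phys. 165 (1994), (6). [ConstantinETiti1994]
-/

noncomputable section

open MeasureTheory TopologicalSpace Set Function Filter Metric UnitAddTorus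
open scoped ENNReal NNReal Convolution Topology

namespace Literature.Analysis.FunctionSpaces

namespace Torus

/-! ## `L³` bookkeeping: cubes and cube roots of lower integrals -/

section Cubes

variable {α : Type*} [MeasurableSpace α] {μ : Measure α} {E : Type*} [NormedAddCommGroup E]

/-- `∫⁻ ‖g‖ₑ³ = ‖g‖³_{L³}`. [folklore] -/
theorem lintegral_enorm_pow_three_eq (g : α → E) :
    ∫⁻ x, ‖g x‖ₑ ^ 3 ∂μ = eLpNorm g 3 μ ^ 3 := by
  rw [eLpNorm_eq_lintegral_rpow_enorm_toReal (by norm_num) (by norm_num)]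
  have h3 : (3 : ℝ≥0∞).toReal = ((3 : ℕ) : ℝ) := by norm_num
  rw [h3, one_div, ENNReal.rpow_inv_natCast_pow (by norm_num)]
  simp

/-- `‖g‖_{L³} = (∫⁻ ‖g‖ₑ³)^{1/3}`. [folklore] -/
theorem eLpNorm_three_eq_rpow (g : α → E) :
    eLpNorm g 3 μ = (∫⁻ x, ‖g x‖ₑ ^ 3 ∂μ) ^ (1 / 3 : ℝ) := by
  rw [lintegral_enorm_pow_three_eq g]
  have h3 : (1 / 3 : ℝ) = ((3 : ℕ) : ℝ)⁻¹ := by norm_num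
  rw [h3, ENNReal.pow_rpow_inv_natCast (by norm_num)]

/-- Cube roots are monotone: `a ≤ b → a^{1/3} ≤ b^{1/3}` in `ℝ≥0∞`. [folklore] -/
theorem rpow_third_le_rpow_third {a b : ℝ≥0∞} (h : a ≤ b) :
    a ^ (1 / 3 : ℝ) ≤ b ^ (1 / 3 : ℝ) :=
  ENNReal.rpow_le_rpow h (by norm_num)

/-- `(a³ · b)^{1/3} = a · b^{1/3}` in `ℝ≥0∞`. [folklore] -/
theorem rpow_third_pow_three_mul (a b : ℝ≥0∞) :
    (a ^ 3 * b) ^ (1 / 3 : ℝ) = a * b ^ (1 / 3 : ℝ) := by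
  rw [ENNReal.mul_rpow_of_nonneg _ _ (by norm_num)]
  have h3 : (1 / 3 : ℝ) = ((3 : ℕ) : ℝ)⁻¹ := by norm_num
  rw [h3, ENNReal.pow_rpow_inv_natCast (by norm_num)]

/-- `(a³)^{1/3} = a` in `ℝ≥0∞`. [folklore] -/
theorem pow_three_rpow_third (a : ℝ≥0∞) : (a ^ 3) ^ (1 / 3 : ℝ) = a := by
  have h3 : (1 / 3 : ℝ) = ((3 : ℕ) : ℝ)⁻¹ := by norm_num
  rw [h3, ENNReal.pow_rpow_inv_natCast (by norm_num)]

end Cubes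

/-! ## Space–time `L³` norms on `(0,T) × T^d` as iterated lower integrals -/

section SpaceTime

variable {d : Type*} [Fintype d] {E : Type*} [NormedAddCommGroup E]

/-- The `L³((0,T) × T^d)` norm of a jointly measurable field as an iterated lower integral:
`‖f‖_{L³(dt dx)} = (∫₀ᵀ ∫ ‖f‖³ dx dt)^{1/3}` (Tonelli). [folklore] -/
theorem eLpNorm_uncurry_three_eq {T : ℝ} {f : ℝ → UnitAddTorus d → E}
    (hf : AEStronglyMeasurable (uncurry f) ((volume.restrict (Ioo 0 T)).prod volume)) :
    eLpNorm (uncurry f) 3 ((volume.restrict (Ioo 0 T)).prod volume) =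
      (∫⁻ t in Ioo 0 T, ∫⁻ x, ‖f t x‖ₑ ^ 3) ^ (1 / 3 : ℝ) := by
  rw [eLpNorm_three_eq_rpow, lintegral_prod _ (hf.enorm.pow_const 3)]
  rfl

/-- **Minkowski in `L³((0,T) × T^d)`, iterated form**: for jointly measurable `f, g`,
`(∫₀ᵀ∫ ‖f + g‖³)^{1/3} ≤ (∫₀ᵀ∫ ‖f‖³)^{1/3} + (∫₀ᵀ∫ ‖g‖³)^{1/3}`. [folklore] -/
theorem rpow_lintegral_add_le {T : ℝ} {f g : ℝ → UnitAddTorus d → E}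
    (hf : AEStronglyMeasurable (uncurry f) ((volume.restrict (Ioo 0 T)).prod volume))
    (hg : AEStronglyMeasurable (uncurry g) ((volume.restrict (Ioo 0 T)).prod volume)) :
    (∫⁻ t in Ioo 0 T, ∫⁻ x, ‖f t x + g t x‖ₑ ^ 3) ^ (1 / 3 : ℝ) ≤
      (∫⁻ t in Ioo 0 T, ∫⁻ x, ‖f t x‖ₑ ^ 3) ^ (1 / 3 : ℝ) +
        (∫⁻ t in Ioo 0 T, ∫⁻ x, ‖g t x‖ₑ ^ 3) ^ (1 / 3 : ℝ) := by
  have hfg : AEStronglyMeasurable (uncurry fun t x => f t x + g t x)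
      ((volume.restrict (Ioo 0 T)).prod volume) := hf.add hg
  rw [← eLpNorm_uncurry_three_eq hf, ← eLpNorm_uncurry_three_eq hg,
    ← eLpNorm_uncurry_three_eq hfg]
  exact eLpNorm_add_le hf hg (by norm_num)

/-- **Minkowski in `L³((0,T) × T^d)`, iterated form, differences.** [folklore] -/
theorem rpow_lintegral_sub_le {T : ℝ} {f g : ℝ → UnitAddTorus d → E}
    (hf : AEStronglyMeasurable (uncurry f) ((volume.restrict (Ioo 0 T)).prod volume))
    (hg : AEStronglyMeasurable (uncurry g) ((volume.restrict (Ioo 0 T)).prod volume)) :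
    (∫⁻ t in Ioo 0 T, ∫⁻ x, ‖f t x - g t x‖ₑ ^ 3) ^ (1 / 3 : ℝ) ≤
      (∫⁻ t in Ioo 0 T, ∫⁻ x, ‖f t x‖ₑ ^ 3) ^ (1 / 3 : ℝ) +
        (∫⁻ t in Ioo 0 T, ∫⁻ x, ‖g t x‖ₑ ^ 3) ^ (1 / 3 : ℝ) := by
  have hfg : AEStronglyMeasurable (uncurry fun t x => f t x - g t x)
      ((volume.restrict (Ioo 0 T)).prod volume) := hf.sub hg
  rw [← eLpNorm_uncurry_three_eq hf, ← eLpNorm_uncurry_three_eq hg,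
    ← eLpNorm_uncurry_three_eq hfg]
  exact eLpNorm_sub_le hf hg (by norm_num)

/-- The time-only `L³(0,T)` norm as a cube root: `‖h‖_{L³(0,T)} = (∫₀ᵀ ‖h‖³)^{1/3}`. [folklore] -/
theorem eLpNorm_restrict_three_eq {E' : Type*} [NormedAddCommGroup E'] {T : ℝ} (h : ℝ → E') :
    eLpNorm h 3 (volume.restrict (Ioo 0 T)) = (∫⁻ t in Ioo 0 T, ‖h t‖ₑ ^ 3) ^ (1 / 3 : ℝ) :=
  eLpNorm_three_eq_rpow h

/-- A function of time alone has the same `L³` norm on `(0,T) × T^d` as on `(0,T)` (the torus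
has volume one). [folklore] -/
theorem lintegral_lintegral_const_right {T : ℝ} (h : ℝ → ℝ≥0∞) :
    ∫⁻ t in Ioo 0 T, ∫⁻ _x : UnitAddTorus d, h t = ∫⁻ t in Ioo 0 T, h t := by
  simp [lintegral_const, measure_univ]

/-- **Joint measurability of jointly smooth fields** on `(0,T) × T^d` (product form). [folklore] -/
theorem IsSmoothSpaceTimeOn.aestronglyMeasurable_uncurry_prod {F : Type*} [NormedAddCommGroup F]
    [NormedSpace ℝ F] {T : ℝ} {u : ℝ → UnitAddTorus d → F} (hu : IsSmoothSpaceTimeOn (Ioo 0 T) u) :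
    AEStronglyMeasurable (uncurry u) ((volume.restrict (Ioo 0 T)).prod volume) := by
  have h1 := aestronglyMeasurable_uncurry_of_stLift_restrict
    (hu.aestronglyMeasurable_stLift measurableSet_Ioo Subset.rfl)
  rwa [Measure.volume_eq_prod, ← Measure.prod_restrict, Measure.restrict_univ] at h1

end SpaceTime


/-! ## The Cauchy criterion -/

section Main

variable {d : Type*} [Fintype d] [DecidableEq d]

omit [DecidableEq d] in
/-- `ρ_ε ⋆ (a - b) = ρ_ε ⋆ a - ρ_ε ⋆ b` pointwise for the torus mollifier and continuous fields
(the tree's `Torus.convolution_sub_right`, restated to keep the imports of this file light). [folklore] -/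
theorem kernel_convolution_sub_right {ε : ℝ} (hε : 0 < ε) (hε' : ε ≤ 1 / 4)
    {a b : UnitAddTorus d → EuclideanSpace ℝ d} (ha : Continuous a) (hb : Continuous b)
    (x : UnitAddTorus d) :
    (kernel ε ⋆ fun y => a y - b y) x = (kernel ε ⋆ a) x - (kernel ε ⋆ b) x := by
  have hk : Integrable (kernel (d := d) ε) volume := (continuous_kernel hε hε').integrable_unitAddTorus
  simp only [convolution_lsmul, smul_sub]
  exact integral_sub (integrable_smul_comp_sub hk ha x) (integrable_smul_comp_sub hk hb x)

omit [DecidableEq d] in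
/-- On the probability space `T^d`, `‖∫ ‖g‖‖ₑ ≤ ‖g‖_{L³}` for continuous `g`: the `L¹` norm is
dominated by the `L³` norm. [folklore] -/
theorem enorm_integral_norm_le_eLpNorm_three {g : UnitAddTorus d → EuclideanSpace ℝ d}
    (hg : Continuous g) : ‖∫ y, ‖g y‖‖ₑ ≤ eLpNorm g 3 volume := by
  rw [Real.enorm_of_nonneg (integral_nonneg fun _ => norm_nonneg _),
    ofReal_integral_norm_eq_lintegral_enorm hg.integrable_unitAddTorus, ← eLpNorm_one_eq_lintegral_enorm]
  exact eLpNorm_le_eLpNorm_of_exponent_le (by norm_num) hg.aestronglyMeasurable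

omit [DecidableEq d] in
/-- `∫ ‖g‖³ dx ≤ ‖g‖³_{B^θ_{3,∞}}` on `T^d` (the Besov norm dominates the `L³` norm). [folklore] -/
theorem lintegral_enorm_pow_three_le_eBesovSupNorm_pow (θ : ℝ) (g : UnitAddTorus d → EuclideanSpace ℝ d) :
    ∫⁻ x, ‖g x‖ₑ ^ 3 ≤ eBesovSupNorm θ 3 g volume ^ 3 := by
  rw [lintegral_enorm_pow_three_eq]
  gcongr
  exact le_self_add

/-- **`L³((0,T) × T^d)` Cauchy criterion: Besov bound in space, convergent Fourier modes in time**
(the Fourier-side Aubin–Lions–Simon argument, Simon 1987, §8; De Rosa–Isett 2024, §6.1). Let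
`w_n` be jointly smooth on `(0,T) × T^d` with `∫₀ᵀ ‖w_n(t)‖³_{B^θ_{3,∞}} ≤ B < ∞` (`θ > 0`) for all
`n`, and suppose that for every frequency `k` the coefficient functions `t ↦ ŵ_n(t,k)` form a
Cauchy sequence in `L³(0,T)`. Then `(w_n)` is Cauchy in `L³((0,T) × T^d)`: for every `η > 0` there
is `N` with `∫₀ᵀ∫ ‖w_n - w_m‖³ ≤ η` for `n, m ≥ N`. Proof: with `ρ_ε = Torus.kernel ε`,
`w_n - w_m = (w_n - ρ_ε⋆w_n) - (w_m - ρ_ε⋆w_m) + ρ_ε⋆(w_n - w_m)`; the first two terms have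
`L³_{t,x}` norm `≤ ε^θ B^{1/3}` (`Torus.eLpNorm_kernel_convolution_sub_self_le_eBesovSupSeminorm`);
the last is bounded pointwise by `∑_{|k|≤K} |ŵ_n(t,k) - ŵ_m(t,k)| + ‖w_n(t) - w_m(t)‖_{L¹} τ_K(ε)`
(`Torus.norm_kernel_convolution_apply_le`) with `τ_K(ε) → 0` as `K → ∞`
(`Torus.tendsto_tsum_compl_norm_mFourierCoeff_kernel`) and `‖w_n(t) - w_m(t)‖_{L¹} ≤ ‖·‖_{L³}`;
choose `ε`, then `K`, then `N`. [cite: Simon1986, §8 Thm. 5] [cite: DeRosaIsett2024, §6.1 (proof of Thm. 2.13)] -/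
theorem exists_forall_lintegral_sub_pow_three_le_of_modes
    {T : ℝ} (hT : 0 < T) {θ : ℝ} (hθ : 0 < θ)
    {w : ℕ → ℝ → UnitAddTorus d → EuclideanSpace ℝ d}
    (hw : ∀ n, IsSmoothSpaceTimeOn (Ioo 0 T) (w n))
    {B : ℝ≥0∞} (hB : B ≠ ⊤)
    (hwB : ∀ n, ∫⁻ t in Ioo 0 T, eBesovSupNorm θ 3 (w n t) volume ^ 3 ≤ B)
    (hmode : ∀ k : d → ℤ, ∀ η : ℝ≥0∞, 0 < η → ∃ N : ℕ, ∀ n m : ℕ, N ≤ n → N ≤ m →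
      ∫⁻ t in Ioo 0 T, ‖mFourierCoeff (EuclideanSpace.complexify ∘ w n t) k -
        mFourierCoeff (EuclideanSpace.complexify ∘ w m t) k‖ₑ ^ 3 ≤ η)
    {η : ℝ≥0∞} (hη : 0 < η) :
    ∃ N : ℕ, ∀ n m : ℕ, N ≤ n → N ≤ m →
      ∫⁻ t in Ioo 0 T, ∫⁻ x, ‖w n t x - w m t x‖ₑ ^ 3 ≤ η := by
  -- the product measure and the cube-root target
  set μT : Measure (ℝ × UnitAddTorus d) := (volume.restrict (Ioo 0 T)).prod volume with hμT
  set ρ : ℝ≥0∞ := η ^ (1 / 3 : ℝ) with hρ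
  have hρpos : 0 < ρ := ENNReal.rpow_pos_of_nonneg hη (by norm_num)
  have hρ3 : 0 < ρ / 3 := ENNReal.div_pos hρpos.ne' (by norm_num)
  set B3 : ℝ≥0∞ := B ^ (1 / 3 : ℝ) with hB3def
  have hB3 : B3 ≠ ⊤ := ENNReal.rpow_ne_top_of_nonneg (by norm_num) hB
  -- Step 1: choice of the mollification scale `ε`
  obtain ⟨ε, hε0, hε4, hεsmall⟩ : ∃ ε : ℝ, 0 < ε ∧ ε ≤ 1 / 4 ∧
      2 * ENNReal.ofReal (ε ^ θ) * B3 ≤ ρ / 3 := by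
    have h1 : Tendsto (fun ε : ℝ => ε ^ θ) (𝓝[>] 0) (𝓝 0) := by
      have h := (Real.continuousAt_rpow_const 0 θ (Or.inr hθ.le)).tendsto
      rw [Real.zero_rpow hθ.ne'] at h
      exact h.mono_left nhdsWithin_le_nhds
    have h2 : Tendsto (fun ε : ℝ => ENNReal.ofReal (ε ^ θ)) (𝓝[>] 0) (𝓝 0) := by
      simpa using ENNReal.tendsto_ofReal h1
    have h3 : Tendsto (fun ε : ℝ => 2 * ENNReal.ofReal (ε ^ θ) * B3) (𝓝[>] 0) (𝓝 0) := by
      have h := ENNReal.Tendsto.mul_const (b := B3)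
        (ENNReal.Tendsto.const_mul h2 (Or.inr (by norm_num : (2 : ℝ≥0∞) ≠ ⊤))) (Or.inr hB3)
      simpa using h
    have hev1 : ∀ᶠ ε in 𝓝[>] (0 : ℝ), 0 < ε := eventually_mem_nhdsWithin
    have hev2 : ∀ᶠ ε in 𝓝[>] (0 : ℝ), ε ≤ 1 / 4 :=
      (ge_mem_nhds (by norm_num : (0 : ℝ) < 1 / 4)).filter_mono nhdsWithin_le_nhds
    have hev3 : ∀ᶠ ε in 𝓝[>] (0 : ℝ), 2 * ENNReal.ofReal (ε ^ θ) * B3 ≤ ρ / 3 :=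
      h3.eventually (ge_mem_nhds hρ3)
    obtain ⟨ε, hε1, hε2, hε3⟩ := (hev1.and (hev2.and hev3)).exists
    exact ⟨ε, hε1, hε2, hε3⟩
  have hkint : Integrable (kernel (d := d) ε) volume := (continuous_kernel hε0 hε4).integrable_unitAddTorus
  -- Step 2: choice of the truncation order `K`
  set τ : ℕ → ℝ := fun K => ∑' k : {k // k ∉ freqBall (d := d) K},
    ‖mFourierCoeff (fun y => (kernel ε y : ℂ)) (k : d → ℤ)‖ with hτ
  have hτ0 : ∀ K, 0 ≤ τ K := fun K => tsum_nonneg fun _ => norm_nonneg _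
  obtain ⟨K, hK⟩ : ∃ K : ℕ, ENNReal.ofReal (τ K) * (2 * B3) ≤ ρ / 3 := by
    have h1 : Tendsto (fun K => ENNReal.ofReal (τ K)) atTop (𝓝 0) := by
      simpa using ENNReal.tendsto_ofReal (tendsto_tsum_compl_norm_mFourierCoeff_kernel (d := d) ε)
    have h2 : Tendsto (fun K => ENNReal.ofReal (τ K) * (2 * B3)) atTop (𝓝 0) := by
      have h := ENNReal.Tendsto.mul_const (b := 2 * B3) h1
        (Or.inr (ENNReal.mul_ne_top (by norm_num) hB3))
      simpa using h
    exact (h2.eventually (ge_mem_nhds hρ3)).exists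
  -- Step 3: choice of `N` from the finitely many modes `|k| ≤ K`
  set c : ℝ≥0∞ := ((freqBall (d := d) K).card : ℝ≥0∞) with hc
  set δ : ℝ≥0∞ := ρ / 3 / c with hδ
  have hδpos : 0 < δ := ENNReal.div_pos hρ3.ne' (ENNReal.natCast_ne_top _)
  have hδ3 : 0 < δ ^ 3 := ENNReal.pow_pos hδpos 3
  choose Nk hNk using fun k : d → ℤ => hmode k (δ ^ 3) hδ3
  refine ⟨(freqBall (d := d) K).sup Nk, fun n m hn hm => ?_⟩
  have hNk' : ∀ k ∈ freqBall (d := d) K, Nk k ≤ n ∧ Nk k ≤ m := fun k hk =>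
    ⟨(Finset.le_sup hk).trans hn, (Finset.le_sup hk).trans hm⟩
  -- Step 4: notation for the pair `(n, m)`
  set D : ℝ → UnitAddTorus d → EuclideanSpace ℝ d := fun t y => w n t y - w m t y with hD
  set P : ℕ → ℝ → UnitAddTorus d → EuclideanSpace ℝ d :=
    fun j t x => w j t x - (kernel ε ⋆ w j t) x with hP
  set Q : ℝ → UnitAddTorus d → EuclideanSpace ℝ d :=
    fun t x => (kernel ε ⋆ w n t) x - (kernel ε ⋆ w m t) x with hQ
  set Dhat : ℝ → (d → ℤ) → EuclideanSpace ℂ d :=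
    fun t k => mFourierCoeff (EuclideanSpace.complexify ∘ D t) k with hDhat
  set S : ℝ → ℝ := fun t => ∑ k ∈ freqBall (d := d) K, ‖Dhat t k‖ with hS
  set mm : ℝ → ℝ := fun t => ∫ y, ‖D t y‖ with hmm
  -- smoothness and measurability
  have hDst : IsSmoothSpaceTimeOn (Ioo 0 T) D := (hw n).sub (hw m)
  have hKst : ∀ j, IsSmoothSpaceTimeOn (Ioo 0 T) (fun t => kernel ε ⋆ w j t) := fun j =>
    (hw j).convolution hkint (convex_Ioo 0 T) (by rw [interior_Ioo]; exact nonempty_Ioo.2 hT)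
  have hmw : ∀ j, AEStronglyMeasurable (uncurry (w j)) μT := fun j =>
    (hw j).aestronglyMeasurable_uncurry_prod
  have hmK : ∀ j, AEStronglyMeasurable (uncurry fun t => kernel ε ⋆ w j t) μT := fun j =>
    (hKst j).aestronglyMeasurable_uncurry_prod
  have hmP : ∀ j, AEStronglyMeasurable (uncurry (P j)) μT := fun j => (hmw j).sub (hmK j)
  have hmQ : AEStronglyMeasurable (uncurry Q) μT := (hmK n).sub (hmK m)
  have hmPP : AEStronglyMeasurable (uncurry fun t x => P n t x - P m t x) μT := (hmP n).sub (hmP m)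
  have hslice : ∀ j, ∀ t ∈ Ioo 0 T, IsSmooth (w j t) := fun j t ht => (hw j).isSmooth_slice ht
  have hDslice : ∀ t ∈ Ioo 0 T, IsSmooth (D t) := fun t ht => hDst.isSmooth_slice ht
  -- (i) decomposition and Minkowski
  have hdecomp : ∀ t x, w n t x - w m t x = (P n t x - P m t x) + Q t x := by
    intro t x
    simp only [hP, hQ]
    abel
  have hMink : (∫⁻ t in Ioo 0 T, ∫⁻ x, ‖w n t x - w m t x‖ₑ ^ 3) ^ (1 / 3 : ℝ) ≤
      (∫⁻ t in Ioo 0 T, ∫⁻ x, ‖P n t x‖ₑ ^ 3) ^ (1 / 3 : ℝ) +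
        (∫⁻ t in Ioo 0 T, ∫⁻ x, ‖P m t x‖ₑ ^ 3) ^ (1 / 3 : ℝ) +
          (∫⁻ t in Ioo 0 T, ∫⁻ x, ‖Q t x‖ₑ ^ 3) ^ (1 / 3 : ℝ) := by
    calc (∫⁻ t in Ioo 0 T, ∫⁻ x, ‖w n t x - w m t x‖ₑ ^ 3) ^ (1 / 3 : ℝ)
        = (∫⁻ t in Ioo 0 T, ∫⁻ x, ‖(P n t x - P m t x) + Q t x‖ₑ ^ 3) ^ (1 / 3 : ℝ) := by
          simp_rw [hdecomp]
      _ ≤ (∫⁻ t in Ioo 0 T, ∫⁻ x, ‖P n t x - P m t x‖ₑ ^ 3) ^ (1 / 3 : ℝ) +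
            (∫⁻ t in Ioo 0 T, ∫⁻ x, ‖Q t x‖ₑ ^ 3) ^ (1 / 3 : ℝ) := rpow_lintegral_add_le hmPP hmQ
      _ ≤ _ := by
          gcongr ?_ + _
          exact rpow_lintegral_sub_le (hmP n) (hmP m)
  -- (ii) the high-frequency parts
  have hhigh : ∀ j, (∫⁻ t in Ioo 0 T, ∫⁻ x, ‖P j t x‖ₑ ^ 3) ^ (1 / 3 : ℝ) ≤
      ENNReal.ofReal (ε ^ θ) * B3 := by
    intro j
    have hsl : ∀ t ∈ Ioo 0 T, ∫⁻ x, ‖P j t x‖ₑ ^ 3 ≤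
        ENNReal.ofReal (ε ^ θ) ^ 3 * eBesovSupNorm θ 3 (w j t) volume ^ 3 := by
      intro t ht
      have h1 : eLpNorm (fun x => (kernel ε ⋆ w j t) x - w j t x) 3 volume ≤
          eBesovSupSeminorm θ 3 (w j t) volume * ENNReal.ofReal (ε ^ θ) :=
        eLpNorm_kernel_convolution_sub_self_le_eBesovSupSeminorm (hslice j t ht).integrable hε0 hε4
          (by norm_num) (by norm_num) hθ
      have h2 : eLpNorm (P j t) 3 volume = eLpNorm (fun x => (kernel ε ⋆ w j t) x - w j t x) 3 volume := by
        have e1 : P j t = (w j t) - (kernel ε ⋆ w j t) := rfl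
        have e2 : (fun x => (kernel ε ⋆ w j t) x - w j t x) = (kernel ε ⋆ w j t) - (w j t) := rfl
        rw [e1, e2, eLpNorm_sub_comm]
      have h3 : eLpNorm (P j t) 3 volume ≤ eBesovSupNorm θ 3 (w j t) volume * ENNReal.ofReal (ε ^ θ) := by
        rw [h2]
        refine h1.trans ?_
        gcongr
        exact le_add_self
      calc ∫⁻ x, ‖P j t x‖ₑ ^ 3 = eLpNorm (P j t) 3 volume ^ 3 := lintegral_enorm_pow_three_eq _
        _ ≤ (eBesovSupNorm θ 3 (w j t) volume * ENNReal.ofReal (ε ^ θ)) ^ 3 := by gcongr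
        _ = ENNReal.ofReal (ε ^ θ) ^ 3 * eBesovSupNorm θ 3 (w j t) volume ^ 3 := by ring
    have hint : ∫⁻ t in Ioo 0 T, ∫⁻ x, ‖P j t x‖ₑ ^ 3 ≤ ENNReal.ofReal (ε ^ θ) ^ 3 * B := by
      calc ∫⁻ t in Ioo 0 T, ∫⁻ x, ‖P j t x‖ₑ ^ 3
          ≤ ∫⁻ t in Ioo 0 T, ENNReal.ofReal (ε ^ θ) ^ 3 * eBesovSupNorm θ 3 (w j t) volume ^ 3 :=
            setLIntegral_mono' measurableSet_Ioo hsl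
        _ = ENNReal.ofReal (ε ^ θ) ^ 3 * ∫⁻ t in Ioo 0 T, eBesovSupNorm θ 3 (w j t) volume ^ 3 :=
            lintegral_const_mul' _ _ (ENNReal.pow_ne_top ENNReal.ofReal_ne_top)
        _ ≤ ENNReal.ofReal (ε ^ θ) ^ 3 * B := by gcongr; exact hwB j
    calc (∫⁻ t in Ioo 0 T, ∫⁻ x, ‖P j t x‖ₑ ^ 3) ^ (1 / 3 : ℝ)
        ≤ (ENNReal.ofReal (ε ^ θ) ^ 3 * B) ^ (1 / 3 : ℝ) := rpow_third_le_rpow_third hint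
      _ = ENNReal.ofReal (ε ^ θ) * B3 := rpow_third_pow_three_mul _ _
  -- (iii) the space–time `L³` norms of the fields and of the difference
  have hwL3 : ∀ j, (∫⁻ t in Ioo 0 T, ∫⁻ x, ‖w j t x‖ₑ ^ 3) ^ (1 / 3 : ℝ) ≤ B3 := by
    intro j
    refine rpow_third_le_rpow_third ((setLIntegral_mono' measurableSet_Ioo fun t _ =>
      lintegral_enorm_pow_three_le_eBesovSupNorm_pow θ (w j t)).trans (hwB j))
  have hDL3 : (∫⁻ t in Ioo 0 T, ∫⁻ y, ‖D t y‖ₑ ^ 3) ^ (1 / 3 : ℝ) ≤ 2 * B3 := by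
    calc (∫⁻ t in Ioo 0 T, ∫⁻ y, ‖D t y‖ₑ ^ 3) ^ (1 / 3 : ℝ)
        ≤ (∫⁻ t in Ioo 0 T, ∫⁻ x, ‖w n t x‖ₑ ^ 3) ^ (1 / 3 : ℝ) +
            (∫⁻ t in Ioo 0 T, ∫⁻ x, ‖w m t x‖ₑ ^ 3) ^ (1 / 3 : ℝ) := rpow_lintegral_sub_le (hmw n) (hmw m)
      _ ≤ B3 + B3 := add_le_add (hwL3 n) (hwL3 m)
      _ = 2 * B3 := (two_mul B3).symm
  -- (iv) the mollified difference: pointwise Fourier bound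
  have hQeq : ∀ t ∈ Ioo 0 T, ∀ x, Q t x = (kernel ε ⋆ D t) x := by
    intro t ht x
    simp only [hQ, hD]
    exact (kernel_convolution_sub_right hε0 hε4 (hslice n t ht).continuous (hslice m t ht).continuous x).symm
  have hQpt : ∀ t ∈ Ioo 0 T, ∀ x, ‖Q t x‖ₑ ^ 3 ≤ ‖S t + mm t * τ K‖ₑ ^ 3 := by
    intro t ht x
    have h1 : ‖Q t x‖ ≤ S t + mm t * τ K := by
      rw [hQeq t ht x]
      exact norm_kernel_convolution_apply_le (hDslice t ht) hε0 hε4 K x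
    have h2 : ‖Q t x‖ₑ ≤ ‖S t + mm t * τ K‖ₑ := by
      rw [← ofReal_norm, ← ofReal_norm]
      exact ENNReal.ofReal_le_ofReal (h1.trans (le_abs_self _))
    gcongr
  -- continuity (hence measurability) in time of the bounding functions
  have hScont : ContinuousOn S (Ioo 0 T) := by
    simp only [hS, hDhat]
    refine continuousOn_finsetSum _ fun k _ => ?_
    exact (continuousOn_mFourierCoeff_of_continuousOn_stLift hDst.continuousOn_stLift k).norm
  have hmmcont : ContinuousOn mm (Ioo 0 T) :=
    continuousOn_integral_of_continuousOn_stLift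
      (continuous_norm.comp_continuousOn hDst.continuousOn_stLift)
  have hSm : AEStronglyMeasurable S (volume.restrict (Ioo 0 T)) :=
    hScont.aestronglyMeasurable measurableSet_Ioo
  have hmmm : AEStronglyMeasurable mm (volume.restrict (Ioo 0 T)) :=
    hmmcont.aestronglyMeasurable measurableSet_Ioo
  have hmmτ : AEStronglyMeasurable (fun t => mm t * τ K) (volume.restrict (Ioo 0 T)) :=
    hmmm.mul_const _
  -- the `L³(0,T)` norm of `mm` is at most the space–time norm of `D`
  have hmmL3 : eLpNorm mm 3 (volume.restrict (Ioo 0 T)) ≤ 2 * B3 := by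
    rw [eLpNorm_restrict_three_eq]
    refine (rpow_third_le_rpow_third (setLIntegral_mono' measurableSet_Ioo fun t ht => ?_)).trans hDL3
    calc ‖mm t‖ₑ ^ 3 ≤ eLpNorm (D t) 3 volume ^ 3 := by
          gcongr
          exact enorm_integral_norm_le_eLpNorm_three (hDslice t ht).continuous
      _ = ∫⁻ y, ‖D t y‖ₑ ^ 3 := (lintegral_enorm_pow_three_eq _).symm
  -- the `L³(0,T)` norm of `S` is at most `c δ ≤ ρ/3`
  have hSL3 : eLpNorm S 3 (volume.restrict (Ioo 0 T)) ≤ ρ / 3 := by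
    have hSeq : S = ∑ k ∈ freqBall (d := d) K, fun t => ‖Dhat t k‖ := by
      funext t
      simp only [hS, Finset.sum_apply]
    have hterm : ∀ k ∈ freqBall (d := d) K,
        eLpNorm (fun t => ‖Dhat t k‖) 3 (volume.restrict (Ioo 0 T)) ≤ δ := by
      intro k hk
      rw [eLpNorm_norm, eLpNorm_restrict_three_eq]
      have hcongr : ∫⁻ t in Ioo 0 T, ‖Dhat t k‖ₑ ^ 3 =
          ∫⁻ t in Ioo 0 T, ‖mFourierCoeff (EuclideanSpace.complexify ∘ w n t) k -
            mFourierCoeff (EuclideanSpace.complexify ∘ w m t) k‖ₑ ^ 3 := by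
        refine setLIntegral_congr_fun measurableSet_Ioo fun t ht => ?_
        simp only [hDhat, hD]
        have e1 : (EuclideanSpace.complexify ∘ fun y => w n t y - w m t y) =
            EuclideanSpace.complexify ∘ w n t - EuclideanSpace.complexify ∘ w m t := by
          funext y
          simp [map_sub]
        rw [e1, mFourierCoeff_sub]
        · exact EuclideanSpace.complexify.toContinuousLinearMap.integrable_comp (hslice n t ht).integrable
        · exact EuclideanSpace.complexify.toContinuousLinearMap.integrable_comp (hslice m t ht).integrable
      rw [hcongr]
      calc (∫⁻ t in Ioo 0 T, ‖mFourierCoeff (EuclideanSpace.complexify ∘ w n t) k -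
            mFourierCoeff (EuclideanSpace.complexify ∘ w m t) k‖ₑ ^ 3) ^ (1 / 3 : ℝ)
          ≤ (δ ^ 3) ^ (1 / 3 : ℝ) :=
            rpow_third_le_rpow_third (hNk k n m (hNk' k hk).1 (hNk' k hk).2)
        _ = δ := pow_three_rpow_third δ
    calc eLpNorm S 3 (volume.restrict (Ioo 0 T))
        = eLpNorm (∑ k ∈ freqBall (d := d) K, fun t => ‖Dhat t k‖) 3 (volume.restrict (Ioo 0 T)) := by
          rw [hSeq]
      _ ≤ ∑ k ∈ freqBall (d := d) K, eLpNorm (fun t => ‖Dhat t k‖) 3 (volume.restrict (Ioo 0 T)) :=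
          eLpNorm_sum_le (fun k _ =>
            ((continuousOn_mFourierCoeff_of_continuousOn_stLift hDst.continuousOn_stLift k).norm
              ).aestronglyMeasurable measurableSet_Ioo) (by norm_num)
      _ ≤ ∑ _k ∈ freqBall (d := d) K, δ := Finset.sum_le_sum hterm
      _ = c * δ := by rw [Finset.sum_const, nsmul_eq_mul]
      _ ≤ ρ / 3 := ENNReal.mul_div_le
  -- the mollified difference in `L³_{t,x}`
  have hQL3 : (∫⁻ t in Ioo 0 T, ∫⁻ x, ‖Q t x‖ₑ ^ 3) ^ (1 / 3 : ℝ) ≤ ρ / 3 + ρ / 3 := by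
    have h1 : ∫⁻ t in Ioo 0 T, ∫⁻ x, ‖Q t x‖ₑ ^ 3 ≤ ∫⁻ t in Ioo 0 T, ‖S t + mm t * τ K‖ₑ ^ 3 := by
      calc ∫⁻ t in Ioo 0 T, ∫⁻ x, ‖Q t x‖ₑ ^ 3
          ≤ ∫⁻ t in Ioo 0 T, ∫⁻ _x : UnitAddTorus d, ‖S t + mm t * τ K‖ₑ ^ 3 :=
            setLIntegral_mono' measurableSet_Ioo fun t ht => lintegral_mono fun x => hQpt t ht x
        _ = ∫⁻ t in Ioo 0 T, ‖S t + mm t * τ K‖ₑ ^ 3 := lintegral_lintegral_const_right _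
    have h2 : (∫⁻ t in Ioo 0 T, ‖S t + mm t * τ K‖ₑ ^ 3) ^ (1 / 3 : ℝ) =
        eLpNorm (fun t => S t + mm t * τ K) 3 (volume.restrict (Ioo 0 T)) :=
      (eLpNorm_restrict_three_eq _).symm
    have h3 : eLpNorm (fun t => S t + mm t * τ K) 3 (volume.restrict (Ioo 0 T)) ≤
        eLpNorm S 3 (volume.restrict (Ioo 0 T)) +
          eLpNorm (fun t => mm t * τ K) 3 (volume.restrict (Ioo 0 T)) :=
      eLpNorm_add_le hSm hmmτ (by norm_num)
    have h4 : eLpNorm (fun t => mm t * τ K) 3 (volume.restrict (Ioo 0 T)) =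
        ENNReal.ofReal (τ K) * eLpNorm mm 3 (volume.restrict (Ioo 0 T)) := by
      have e1 : (fun t => mm t * τ K) = (τ K) • mm := by
        funext t
        simp [mul_comm]
      rw [e1, eLpNorm_const_smul, Real.enorm_of_nonneg (hτ0 K)]
    calc (∫⁻ t in Ioo 0 T, ∫⁻ x, ‖Q t x‖ₑ ^ 3) ^ (1 / 3 : ℝ)
        ≤ (∫⁻ t in Ioo 0 T, ‖S t + mm t * τ K‖ₑ ^ 3) ^ (1 / 3 : ℝ) := rpow_third_le_rpow_third h1
      _ ≤ eLpNorm S 3 (volume.restrict (Ioo 0 T)) +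
            ENNReal.ofReal (τ K) * eLpNorm mm 3 (volume.restrict (Ioo 0 T)) := by rw [h2, ← h4]; exact h3
      _ ≤ ρ / 3 + ENNReal.ofReal (τ K) * (2 * B3) := by gcongr
      _ ≤ ρ / 3 + ρ / 3 := by gcongr
  -- (v) conclusion
  have hfinal : (∫⁻ t in Ioo 0 T, ∫⁻ x, ‖w n t x - w m t x‖ₑ ^ 3) ^ (1 / 3 : ℝ) ≤ ρ := by
    calc (∫⁻ t in Ioo 0 T, ∫⁻ x, ‖w n t x - w m t x‖ₑ ^ 3) ^ (1 / 3 : ℝ)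
        ≤ ENNReal.ofReal (ε ^ θ) * B3 + ENNReal.ofReal (ε ^ θ) * B3 + (ρ / 3 + ρ / 3) :=
          hMink.trans (add_le_add (add_le_add (hhigh n) (hhigh m)) hQL3)
      _ = 2 * ENNReal.ofReal (ε ^ θ) * B3 + (ρ / 3 + ρ / 3) := by ring
      _ ≤ ρ / 3 + (ρ / 3 + ρ / 3) := by gcongr
      _ = ρ := by rw [← add_assoc, ENNReal.add_thirds]
  have hcube : ∀ a : ℝ≥0∞, (a ^ (1 / 3 : ℝ)) ^ 3 = a := fun a => by
    rw [show (1 / 3 : ℝ) = ((3 : ℕ) : ℝ)⁻¹ by norm_num, ENNReal.rpow_inv_natCast_pow (by norm_num)]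
  calc ∫⁻ t in Ioo 0 T, ∫⁻ x, ‖w n t x - w m t x‖ₑ ^ 3
      = ((∫⁻ t in Ioo 0 T, ∫⁻ x, ‖w n t x - w m t x‖ₑ ^ 3) ^ (1 / 3 : ℝ)) ^ 3 := (hcube _).symm
    _ ≤ ρ ^ 3 := by gcongr
    _ = η := hcube η

end Main

end Torus

end Literature.Analysis.FunctionSpaces

end
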